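import Literature.MathematicalPhysics.KineticTheory.FouriersLaw
import Literature.MathematicalPhysics.KineticTheory.LangevinChainGibbs
import Literature.MathematicalPhysics.KineticTheory.LangevinSemigroup

/-!
# Crux `StieltjesRepresentation` (stmt-AtomisticToContinuum-15248) — ideator 4 (g2), round 2: first lemmas

Both cards act on the φ⁴ edge `stub_phi4Edge` (β = 0 < lam) of the crux (kernel fact
`CayleyPencil.stieltjesRepresentation_iff_phi4Edge`).  Nothing here is proved; these are the
first checkable statements of the two lines, typed over existing declarations.

* Card A `breather-graded-lyapunov`: `SubgeometricDrift` / `BreatherGradedDrift` — a Gibbs-tempered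
  SUBGEOMETRIC Foster–Lyapunov drift `L W ≤ C − c W^a` for the φ⁴ chain, uniform for bath
  temperatures in a window around `T` (the barrier `StrongPinningBreathers*` forbids only the
  GEOMETRIC drift `L V ≤ C − c V`).
* Card B `gibbs-weighted-hypocoercivity`: `EquilibriumL2Decay` — integrable `L^∞ → L²(μ_T)` decay of
  the EQUILIBRIUM semigroup (weak hypocoercivity; reference measure = the explicit Gibbs measure),
  and its pointwise residue `NESSExponentialMoments` (Bochner-guarded with `Integrable`).
-/

noncomputable section

open MeasureTheory Set Filter Topology
open scoped NNReal

namespace Summit.AtomisticToContinuum.FouriersLaw.Cruxes.StieltjesRepresentation.IdeasK4g2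

open Literature.MathematicalPhysics.KineticTheory.HeatConduction

/-- The φ⁴ chain at the edge of the crux's parameter range: pinning `ω₂ q²/2 + lam q⁴/4`,
HARMONIC coupling (`β = 0`), bath friction `γ`. -/
abbrev phi4 (ω₂ lam γ : ℝ) : OscillatorChain := pinnedChain ω₂ lam 0 γ

/-- **Card A, first lemma (fixed parameters).** A `C²` Lyapunov function `W ≥ 1`, polynomially
bounded in `1 + H` (Gibbs-tempered: all its moments are Gibbs-finite), whose SUBGEOMETRIC drift term
dominates the energy (`1 + H ≤ c W^a`, so that Glynn–Meyn bounds apply to sources `|g| ≲ 1 + H`,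
e.g. `p₀² − T` and the bond currents), with `L_{T_L,T_R} W ≤ C − c · W^a` (`0 < a < 1`) POINTWISE
for all bath temperatures within `δ₀` of `T`.  (`W` is not a function of `H` alone — conjunct (3)
of `StrongPinningBreathersNarrow_holds` forbids that.) -/
def SubgeometricDrift (ω₂ lam γ T : ℝ) (N : ℕ) : Prop :=
  ∃ (W : PhaseSpace N → ℝ) (a c C δ₀ : ℝ) (m : ℕ),
    0 < a ∧ a < 1 ∧ 0 < c ∧ 0 < δ₀ ∧ δ₀ < T ∧ ContDiff ℝ 2 W ∧ (∀ x, 1 ≤ W x) ∧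
    (∀ x, 1 + (phi4 ω₂ lam γ).hamiltonian N x ≤ c * (W x) ^ a) ∧
    (∀ x, W x ≤ C * (1 + (phi4 ω₂ lam γ).hamiltonian N x) ^ m) ∧
    ∀ T_L T_R : ℝ, |T_L - T| ≤ δ₀ → |T_R - T| ≤ δ₀ →
      ∀ x, (phi4 ω₂ lam γ).generator N T_L T_R W x ≤ C - c * (W x) ^ a

/-- **Card A, first lemma (the line's opening statement).** -/
def BreatherGradedDrift : Prop :=
  ∀ ω₂ lam γ T : ℝ, 0 < ω₂ → 0 < lam → 0 < γ → 0 < T →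
    ∀ N : ℕ, 2 ≤ N → SubgeometricDrift ω₂ lam γ T N

/-- **Card A, strong (exponential-weight) variant.** `W ≍ exp(θ H)` with `θ (T + δ₀) < 1` and the
logarithmically degraded drift `L W ≤ C − c W / (1 + log W)^b` (rate `exp(−c t^{1/(1+b)})`). -/
def ExpWeightDrift (ω₂ lam γ T : ℝ) (N : ℕ) : Prop :=
  ∃ (W : PhaseSpace N → ℝ) (θ b c C δ₀ : ℝ),
    0 < θ ∧ 0 < δ₀ ∧ δ₀ < T ∧ θ * (T + δ₀) < 1 ∧ 0 ≤ b ∧ 0 < c ∧ ContDiff ℝ 2 W ∧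
    (∀ x, Real.exp (θ * (phi4 ω₂ lam γ).hamiltonian N x) ≤ W x) ∧
    (∀ x, W x ≤ C * Real.exp (θ * (phi4 ω₂ lam γ).hamiltonian N x)) ∧
    ∀ T_L T_R : ℝ, |T_L - T| ≤ δ₀ → |T_R - T| ≤ δ₀ →
      ∀ x, (phi4 ω₂ lam γ).generator N T_L T_R W x ≤ C - c * W x / (1 + Real.log (W x)) ^ b

/-- **Card B, first lemma (fixed parameters).** Integrable `L^∞ → L²(μ_T)` decay of the
equilibrium semigroup of the φ⁴ chain (both baths at `T`): for every Langevin semigroup `S` of the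
chain leaving the Gibbs measure `μ_T` invariant there is `r ∈ L¹(0,∞)` with
`‖S_t ψ − μ_T(ψ)‖_{L²(μ_T)} ≤ r(t)` for all measurable `|ψ| ≤ 1`. (A weak Poincaré inequality with
`α(r) ≲ log(1/r)^{a_N}` gives `r(t) = C exp(−c t^{1/(1+a_N)})`.)  Per-`N`: the rate may degrade
with `N` (the refuted `OddCorrectorDecay`, stmt-9139, asked for an `N`-uniform bound). -/
def EquilibriumL2Decay (ω₂ lam γ T : ℝ) (N : ℕ) : Prop :=
  ∀ S : LangevinChainSemigroup (phi4 ω₂ lam γ) N T T,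
    S.IsInvariant ((phi4 ω₂ lam γ).gibbsMeasure N T) →
    ∃ r : ℝ → ℝ, IntegrableOn r (Ioi 0) ∧ ∀ t : ℝ, 0 < t →
      ∀ ψ : PhaseSpace N → ℝ, Measurable ψ → (∀ z, |ψ z| ≤ 1) →
        ∫ z, (S.act t.toNNReal ψ z - ∫ y, ψ y ∂((phi4 ω₂ lam γ).gibbsMeasure N T)) ^ 2
            ∂((phi4 ω₂ lam γ).gibbsMeasure N T) ≤ (r t) ^ 2

/-- **Card B, the line's opening statement.** -/
def GibbsWeightedHypocoercivity : Prop :=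
  ∀ ω₂ lam γ T : ℝ, 0 < ω₂ → 0 < lam → 0 < γ → 0 < T →
    ∀ N : ℕ, 2 ≤ N → EquilibriumL2Decay ω₂ lam γ T N

/-- **Card B, pointwise residue.** Exponential moments of every weak steady state at order
`θ > 1/(2T)`, uniformly for bath temperatures within `δ₀` of `T` (the `L² → pointwise` transfer
loses `exp(H/2T)`; `1/(2T) < 1/T_L` is the Gaussian room).  Guarded with `Integrable` so that the
Bochner integral is not a junk value. -/
def NESSExponentialMoments (ω₂ lam γ T : ℝ) (N : ℕ) : Prop :=
  ∃ θ δ₀ M : ℝ, 1 / (2 * T) < θ ∧ 0 < δ₀ ∧ δ₀ < T ∧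
    ∀ T_L T_R : ℝ, |T_L - T| ≤ δ₀ → |T_R - T| ≤ δ₀ →
      ∀ μ : Measure (PhaseSpace N), (phi4 ω₂ lam γ).IsSteadyState N T_L T_R μ →
        Integrable (fun x => Real.exp (θ * (phi4 ω₂ lam γ).hamiltonian N x)) μ ∧
          ∫ x, Real.exp (θ * (phi4 ω₂ lam γ).hamiltonian N x) ∂μ ≤ M

/-- **Card B, free input (U): the exponential supermartingale bound behind the up-crossing
estimate.** Pointwise `L_{T_L,T_R} e^{θH} ≤ θ γ (T_L + T_R) e^{θH}` whenever `θ T_L ≤ 1`,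
`θ T_R ≤ 1` (one-line computation `L e^{θH} = θγ e^{θH}[T_L + T_R − p₀²(1−θT_L) − p_{N−1}²(1−θT_R)]`). -/
def ExpEnergySupersolution (ω₂ lam γ : ℝ) (N : ℕ) : Prop :=
  ∀ θ T_L T_R : ℝ, 0 ≤ θ → 0 ≤ T_L → 0 ≤ T_R → θ * T_L ≤ 1 → θ * T_R ≤ 1 → 0 ≤ γ →
    ∀ x, (phi4 ω₂ lam γ).generator N T_L T_R
        (fun y => Real.exp (θ * (phi4 ω₂ lam γ).hamiltonian N y)) x ≤
      θ * γ * (T_L + T_R) * Real.exp (θ * (phi4 ω₂ lam γ).hamiltonian N x)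

end Summit.AtomisticToContinuum.FouriersLaw.Cruxes.StieltjesRepresentation.IdeasK4g2

end
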